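import Mathlib.MeasureTheory.Measure.Tight
import Literature.MathematicalPhysics.KineticTheory.InfiniteChainBoundaryTransferForm
import Literature.MathematicalPhysics.KineticTheory.InfiniteChainGibbsNormalisable
import Literature.MathematicalPhysics.KineticTheory.InfiniteChainInvariantStates
import Literature.Probability.LatticeModels.IntervalGibbsRatioLimit
import Literature.Probability.LatticeModels.DLRUniquenessCriterion
import HarnessLib

/-!
# Uniqueness of the shift-invariant DLR Gibbs state of the infinite oscillator chain

Topic `Literature/MathematicalPhysics/KineticTheory`; theorems only (no definitions, no named
facts). For a nearest-neighbour chain `P : OscillatorChain` with continuous pinning `U`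
(`e^{-U/T}` Lebesgue integrable) and continuous, even, non-negative coupling `V`, at every
temperature `T > 0` there is AT MOST ONE translation-invariant infinite-volume Gibbs state
(`IsChainGibbsMeasure` + `IsShiftInvariant`); in particular the regular thermal state of the pinned
anharmonic chain `pinnedChain ω₂ lam β γ` (`U = ω₂q²/2 + lam q⁴/4`, `V = r²/2 + βr⁴/4`) is unique.

Proof (the classical transfer-operator argument, Georgii 2011 Thm 10.25 / §11.1;
Cassandro–Olivieri–Pellegrinotti–Presutti 1978 §2 for unbounded spins): the finite-volume kernel
`γ_Λ(A | η)` of a cylinder event on an interval `Λ` is a ratio of interval Boltzmann integrals,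
which `Literature.Probability.LatticeModels.exists_limit_lmarginal_interval_ratio` (transfer
operator `e^{-V(q'-q)/T}` on `L²(e^{-(p²/2+U)/T} dq dp)`: Hilbert–Schmidt, strictly positive;
Jentzsch's spectral gap + power iteration) shows to converge as `Λ ↑ ℤ`, UNIFORMLY over boundary
conditions whose two boundary spins stay in a compact set; a shift-invariant state has identical,
hence uniformly tight, one-site marginals, so the abstract DLR step
`Literature.Probability.LatticeModels.measure_eq_of_dlr_of_boundaryUniform` applies.

* `IsShiftInvariant.measure_eval_mem_eq`, `IsShiftInvariant.exists_isCompact_forall_measure_le` —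
  one-site marginals of a shift-invariant state coincide and are uniformly tight;
* `chainSpecification_boundaryUniform` — boundary-uniform convergence of `γ_Λ(A|·)` on cylinders;
* `eq_of_isChainGibbsMeasure_of_isShiftInvariant` (**main**) and its `pinnedChain` instance
  `pinnedChain_eq_of_isChainGibbsMeasure_of_isShiftInvariant`.

No temperedness / superstability hypothesis is needed besides shift-invariance (non-tempered DLR
states of the chain, e.g. Gaussian states centred on exponentially growing static profiles of the
harmonic chain, are not shift-invariant). [cite: Georgii2011, Thm 10.25 and §11.1]
-/

noncomputable section

open MeasureTheory Filter Set Function Finset Literature.Probability.LatticeModels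
open scoped ENNReal

namespace Literature.MathematicalPhysics.KineticTheory.HeatConduction

/-! ### One-site marginals of shift-invariant states -/

/-- **The one-site marginals of a shift-invariant state coincide**: `μ(η_x ∈ E) = μ(η_0 ∈ E)`.
[folklore] -/
theorem IsShiftInvariant.measure_eval_mem_eq {μ : Measure ChainConfig} (hμ : IsShiftInvariant μ)
    {E : Set (ℝ × ℝ)} (hE : MeasurableSet E) (x : ℤ) :
    μ {η : ChainConfig | η x ∈ E} = μ {η : ChainConfig | η 0 ∈ E} := by
  have hsm : Measurable (shift : ChainConfig → ChainConfig) :=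
    measurable_pi_lambda _ fun y => measurable_pi_apply _
  have step : ∀ y : ℤ, μ {η : ChainConfig | η (y + 1) ∈ E} = μ {η : ChainConfig | η y ∈ E} := by
    intro y
    have hmeas : MeasurableSet {η : ChainConfig | η y ∈ E} := measurable_pi_apply y hE
    have hpre : {η : ChainConfig | η (y + 1) ∈ E} = shift ⁻¹' {η : ChainConfig | η y ∈ E} := by
      ext η; rfl
    rw [hpre, ← Measure.map_apply hsm hmeas, hμ]
  induction x using Int.induction_on with
  | zero => rfl
  | succ n ih => rw [step, ih]
  | pred n ih => rw [← ih, ← step (-(n : ℤ) - 1)]; simp only [sub_add_cancel]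

/-- **Uniform tightness of the one-site marginals of a shift-invariant finite measure** on
`ℤ → ℝ × ℝ`: for every `δ > 0` one compact `C ⊆ ℝ × ℝ` has `μ(η_x ∉ C) ≤ δ` for ALL sites `x`
(tightness of the single finite measure `μ ∘ η_0⁻¹` on the Polish space `ℝ × ℝ`). [folklore] -/
theorem IsShiftInvariant.exists_isCompact_forall_measure_le {μ : Measure ChainConfig}
    [IsFiniteMeasure μ] (hμ : IsShiftInvariant μ) {δ : ℝ} (hδ : 0 < δ) :
    ∃ C : Set (ℝ × ℝ), IsCompact C ∧ ∀ x : ℤ, μ {η : ChainConfig | η x ∉ C} ≤ ENNReal.ofReal δ := by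
  have h0 : Measurable fun η : ChainConfig => η 0 := measurable_pi_apply 0
  have ht := isTightMeasureSet_singleton (μ := μ.map fun η : ChainConfig => η 0)
  rw [isTightMeasureSet_iff_exists_isCompact_measure_compl_le] at ht
  obtain ⟨C, hC, hle⟩ := ht (ENNReal.ofReal δ) (ENNReal.ofReal_pos.2 hδ)
  refine ⟨C, hC, fun x => ?_⟩
  have h1 := hle _ (mem_singleton _)
  rw [Measure.map_apply h0 hC.isClosed.measurableSet.compl] at h1
  have h2 := hμ.measure_eval_mem_eq hC.isClosed.measurableSet.compl x
  exact h2.le.trans h1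

namespace OscillatorChain

variable (P : OscillatorChain)

/-! ### Boundary-uniform convergence of the finite-volume kernels on cylinder events -/

/-- **The finite-volume Gibbs kernels of the chain converge, uniformly over boundary conditions
with boundary spins in a compact set.** Let `T > 0`, `U`, `V` continuous, `V ≥ 0` even, `e^{-U/T}`
integrable, and `A` a measurable cylinder event. Then there is `L ∈ ℝ` such that for every compact
`C ⊆ ℝ × ℝ` and `ε > 0` some interval `Λ` and its two boundary sites `B` satisfy
`|γ_Λ(A | η) - L| ≤ ε` for every `η` with `η(B) ⊆ C` (transfer operator; Georgii 2011,
Thm 10.25 / §11.1). [cite: Georgii2011, Thm 10.25 and §11.1] -/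
theorem chainSpecification_boundaryUniform {T : ℝ} (hT : 0 < T) (hUc : Continuous P.U)
    (hVc : Continuous P.V) (hV0 : ∀ r, 0 ≤ P.V r) (hVe : ∀ r, P.V (-r) = P.V r)
    (hUi : Integrable (fun q : ℝ => Real.exp (-T⁻¹ * P.U q))) {A : Set ChainConfig}
    (hA : A ∈ measurableCylinders fun _ : ℤ => ℝ × ℝ) :
    ∃ L : ℝ, ∀ C : Set (ℝ × ℝ), IsCompact C → ∀ ε : ℝ, 0 < ε → ∃ (Λ B : Finset ℤ), B.card ≤ 2 ∧
      ∀ η : ChainConfig, (∀ b ∈ B, η b ∈ C) → |(P.chainSpecification T Λ η A).toReal - L| ≤ ε := by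
  classical
  have hUm : Measurable P.U := hUc.measurable
  have hVm : Measurable P.V := hVc.measurable
  -- the cylinder and its window
  have hAm : MeasurableSet A := MeasurableSet.of_mem_measurableCylinders hA
  obtain ⟨I, S₀, hS₀, rfl⟩ := (mem_measurableCylinders _).1 hA
  set R : ℕ := I.sup Int.natAbs with hR
  set a : ℤ := -(R : ℤ) - 1 with ha
  set n : ℕ := 2 * R with hn
  have hIsub : (↑I : Set ℤ) ⊆ ↑(Finset.Icc (a + 1) (a + 1 + n)) := by
    have h := subset_Icc_sup_natAbs I
    have h1 : a + 1 = -((I.sup Int.natAbs : ℕ) : ℤ) := by rw [ha, hR]; ring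
    rw [h1, hn, hR]
    exact Finset.coe_subset.2 h
  -- the observable
  set Φ : ChainConfig → ℝ≥0∞ := (cylinder I S₀).indicator 1 with hΦ
  have hΦm : Measurable Φ := measurable_one.indicator hAm
  have hΦd0 : DependsOn ((MeasureTheory.cylinder (α := fun _ : ℤ => ℝ × ℝ) I S₀).indicator
      fun _ => (1 : ℝ≥0∞)) (↑I : Set ℤ) :=
    dependsOn_cylinder_indicator_const (α := fun _ : ℤ => ℝ × ℝ) (I := I) S₀ (1 : ℝ≥0∞)
  have hΦd : DependsOn Φ (↑(Finset.Icc (a + 1) (a + 1 + n)) : Set ℤ) := hΦd0.mono hIsub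
  have hΦ1 : ∀ σ, Φ σ ≤ 1 := fun σ => by
    rw [hΦ]; by_cases hσ : σ ∈ cylinder I S₀ <;> simp [hσ]
  -- the transfer data: one-site weight `w`, bond kernel `K`, `k = ofReal ∘ K`
  obtain ⟨w, hw⟩ : ∃ w : ℝ × ℝ → ℝ≥0∞, ∀ z,
      w z = ENNReal.ofReal (Real.exp (-T⁻¹ * (z.2 ^ 2 / 2 + P.U z.1))) := ⟨_, fun _ => rfl⟩
  obtain ⟨K, hK⟩ : ∃ K : ℝ × ℝ → ℝ × ℝ → ℝ, ∀ z z', K z z' = Real.exp (-T⁻¹ * P.V (z'.1 - z.1)) :=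
    ⟨_, fun _ _ => rfl⟩
  obtain ⟨k, hk⟩ : ∃ k : ℝ × ℝ → ℝ × ℝ → ℝ≥0∞, ∀ z z', k z z' = ENNReal.ofReal (K z z') :=
    ⟨_, fun _ _ => rfl⟩
  obtain ⟨B, hB⟩ : ∃ B : ℤ → ℕ → ChainConfig → ℝ≥0∞, ∀ a n σ, B a n σ =
      (∏ j ∈ Finset.range n, k (σ (a + j)) (σ (a + j + 1))) *
        ∏ j ∈ Finset.range (n + 1), w (σ (a + j)) := ⟨_, fun _ _ _ => rfl⟩
  obtain ⟨Tr, hTr⟩ : ∃ Tr : (ℝ × ℝ → ℝ≥0∞) → (ℝ × ℝ → ℝ≥0∞), ∀ f z,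
      Tr f z = ∫⁻ y, k z y * f y * w y ∂(volume : Measure (ℝ × ℝ)) := ⟨_, fun _ _ => rfl⟩
  have hwc : Continuous fun z : ℝ × ℝ => Real.exp (-T⁻¹ * (z.2 ^ 2 / 2 + P.U z.1)) := by fun_prop
  have hwm : Measurable w := by
    rw [show w = fun z => ENNReal.ofReal (Real.exp (-T⁻¹ * (z.2 ^ 2 / 2 + P.U z.1))) from funext hw]
    exact ENNReal.measurable_ofReal.comp hwc.measurable
  have hwi : ∫⁻ y, w y ∂(volume : Measure (ℝ × ℝ)) ≠ ∞ := by
    have hint := P.integrable_siteWeight hT hUi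
    rw [show w = fun z => ENNReal.ofReal (Real.exp (-T⁻¹ * (z.2 ^ 2 / 2 + P.U z.1))) from funext hw]
    exact ((hasFiniteIntegral_iff_ofReal (Eventually.of_forall fun z => (Real.exp_pos _).le)).1
      hint.hasFiniteIntegral).ne
  have hwpos : ∀ y, w y ≠ 0 := fun y => by
    rw [hw]; exact (ENNReal.ofReal_pos.2 (Real.exp_pos _)).ne'
  have hKc' : Continuous (uncurry K) := by
    rw [show uncurry K = fun p : (ℝ × ℝ) × (ℝ × ℝ) => Real.exp (-T⁻¹ * P.V (p.2.1 - p.1.1)) from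
      funext fun p => hK p.1 p.2]
    fun_prop
  have hKsm : StronglyMeasurable (uncurry K) := hKc'.stronglyMeasurable
  have hKc : ∀ y, Continuous fun u => K u y := fun y =>
    hKc'.comp (continuous_id.prodMk continuous_const)
  have hKpos : ∀ z z', 0 < K z z' := fun z z' => by rw [hK]; exact Real.exp_pos _
  have hK1 : ∀ z z', ‖K z z'‖ ≤ 1 := fun z z' => by
    rw [Real.norm_eq_abs, abs_of_pos (hKpos z z'), hK, Real.exp_le_one_iff]
    have := hV0 (z'.1 - z.1)
    have := inv_pos.2 hT
    nlinarith
  have hKsymm : ∀ z z', K z z' = K z' z := fun z z' => by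
    rw [hK, hK, ← hVe (z.1 - z'.1), neg_sub]
  have hν : (volume : Measure (ℝ × ℝ)) ≠ 0 := by
    intro h0
    have : (volume : Measure (ℝ × ℝ)) univ = 0 := by rw [h0]; rfl
    exact (isOpen_univ.measure_pos (volume : Measure (ℝ × ℝ)) univ_nonempty).ne' this
  -- the factorisation of the Boltzmann weight
  have hfac : ∀ (Λ : Finset ℤ) (σ : ChainConfig),
      ENNReal.ofReal (Real.exp (-T⁻¹ * hamiltonianIn P.chainPotential chainSupp Λ σ)) =
        (∏ x ∈ Λ, w (σ x)) * ∏ y ∈ bondSet Λ, k (σ y) (σ (y + 1)) := fun Λ σ => by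
    rw [P.ofReal_exp_neg_hamiltonianIn T Λ σ]
    simp only [hw, hk, hK]
  -- the transfer-operator limit
  obtain ⟨L, hL⟩ := exists_limit_lmarginal_interval_ratio (ν := (volume : Measure (ℝ × ℝ))) hν hwm
    hwi hwpos hKsm hKc hK1 hKsymm hKpos hk hB hTr hΦm hΦd hΦ1
  refine ⟨L, fun C hC ε hε => ?_⟩
  obtain ⟨i₀, hi₀⟩ := hL C hC ε hε
  refine ⟨Finset.Icc (a - i₀) (a + ((n + 2 : ℕ) : ℤ) + 1 + i₀),
    {a - i₀ - 1, a + ((n + 2 : ℕ) : ℤ) + i₀ + 2}, Finset.card_le_two, fun η hη => ?_⟩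
  have hu : η (a - i₀ - 1) ∈ C := hη _ (by simp)
  have hv : η (a + ((n + 2 : ℕ) : ℤ) + i₀ + 2) ∈ C := hη _ (by simp)
  have key := hi₀ i₀ le_rfl η hu hv
  rw [P.chainSpecification_apply_eq_lmarginal_div hUm hVm T _ η hAm]
  have hbond : bondSet (Finset.Icc (a - i₀) (a + ((n + 2 : ℕ) : ℤ) + 1 + i₀)) =
      Finset.Icc (a - i₀ - 1) (a + ((n + 2 : ℕ) : ℤ) + 1 + i₀) :=
    bondSet_Icc (by push_cast; omega)
  have hW : (fun σ : ChainConfig => ENNReal.ofReal (Real.exp (-T⁻¹ *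
      hamiltonianIn P.chainPotential chainSupp (Finset.Icc (a - i₀) (a + ((n + 2 : ℕ) : ℤ) + 1 + i₀)) σ))) =
      fun σ => (∏ x ∈ Finset.Icc (a - i₀) (a + ((n + 2 : ℕ) : ℤ) + 1 + i₀), w (σ x)) *
        ∏ y ∈ Finset.Icc (a - i₀ - 1) (a + ((n + 2 : ℕ) : ℤ) + 1 + i₀), k (σ y) (σ (y + 1)) := by
    funext σ; rw [hfac, hbond]
  have hWΦ : (fun σ : ChainConfig => (cylinder I S₀).indicator 1 σ * ENNReal.ofReal (Real.exp (-T⁻¹ *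
      hamiltonianIn P.chainPotential chainSupp (Finset.Icc (a - i₀) (a + ((n + 2 : ℕ) : ℤ) + 1 + i₀)) σ))) =
      fun σ => Φ σ * ((∏ x ∈ Finset.Icc (a - i₀) (a + ((n + 2 : ℕ) : ℤ) + 1 + i₀), w (σ x)) *
        ∏ y ∈ Finset.Icc (a - i₀ - 1) (a + ((n + 2 : ℕ) : ℤ) + 1 + i₀), k (σ y) (σ (y + 1))) := by
    funext σ; rw [hfac, hbond]
  rw [hW, hWΦ]
  exact key.le

/-! ### Uniqueness -/

/-- **Uniqueness of the shift-invariant Gibbs state of the chain.** Let `T > 0`, `U`, `V`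
continuous, `V ≥ 0` even, `e^{-U/T}` Lebesgue integrable. Then two translation-invariant DLR
Gibbs states of the chain `P` at temperature `T` are EQUAL (one-dimensional nearest-neighbour model
with a strictly positive Hilbert–Schmidt transfer operator; Georgii 2011, Thm 10.25 / §11.1;
Cassandro–Olivieri–Pellegrinotti–Presutti 1978, §2). [cite: Georgii2011, Thm 10.25 and §11.1] -/
theorem eq_of_isChainGibbsMeasure_of_isShiftInvariant {T : ℝ} (hT : 0 < T) (hUc : Continuous P.U)
    (hVc : Continuous P.V) (hV0 : ∀ r, 0 ≤ P.V r) (hVe : ∀ r, P.V (-r) = P.V r)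
    (hUi : Integrable (fun q : ℝ => Real.exp (-T⁻¹ * P.U q))) {μ₁ μ₂ : Measure ChainConfig}
    (h₁ : P.IsChainGibbsMeasure T μ₁) (hs₁ : IsShiftInvariant μ₁)
    (h₂ : P.IsChainGibbsMeasure T μ₂) (hs₂ : IsShiftInvariant μ₂) : μ₁ = μ₂ := by
  haveI : IsProbabilityMeasure μ₁ := h₁.1
  haveI : IsProbabilityMeasure μ₂ := h₂.1
  have hUm : Measurable P.U := hUc.measurable
  have hVm : Measurable P.V := hVc.measurable
  have hUi' : Integrable (fun q : ℝ => Real.exp (-P.U q / T)) := by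
    refine hUi.congr (Eventually.of_forall fun q => ?_)
    show Real.exp (-T⁻¹ * P.U q) = Real.exp (-P.U q / T)
    congr 1; rw [div_eq_mul_inv]; ring
  have hγp : ∀ (Λ : Finset ℤ) (η : ChainConfig), IsProbabilityMeasure (P.chainSpecification T Λ η) :=
    P.condB2_of_integrable_exp_neg hT hUc hVc hV0 hUi'
  refine measure_eq_of_dlr_of_boundaryUniform (P.chainSpecification T)
    (𝒜 := measurableCylinders fun _ : ℤ => ℝ × ℝ) generateFrom_measurableCylinders.symm
    isPiSystem_measurableCylinders hγp
    (fun A hA Λ => P.measurable_chainSpecification_apply hUm hVm T Λ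
      (MeasurableSet.of_mem_measurableCylinders hA)) 2
    (fun A hA => P.chainSpecification_boundaryUniform hT hUc hVc hV0 hVe hUi hA) μ₁ μ₂
    (fun Λ A hA => h₁.2 Λ A (MeasurableSet.of_mem_measurableCylinders hA))
    (fun Λ A hA => h₂.2 Λ A (MeasurableSet.of_mem_measurableCylinders hA))
    (fun δ hδ => hs₁.exists_isCompact_forall_measure_le hδ)
    (fun δ hδ => hs₂.exists_isCompact_forall_measure_le hδ)

/-- **The pinned anharmonic chain has at most one shift-invariant Gibbs state at every
temperature.** For `pinnedChain ω₂ lam β γ` (`U = ω₂q²/2 + lam q⁴/4`, `V = r²/2 + βr⁴/4`) with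
`ω₂ > 0`, `lam, β ≥ 0` and `T > 0`, any two translation-invariant DLR Gibbs states coincide; a
fortiori the regular (shift-invariant, Buttà–Marchioro superstable) thermal state
(`exists_isChainGibbsMeasure_shiftInvariant_superstable_pinnedChain`) is unique.
[cite: Georgii2011, Thm 10.25 and §11.1] -/
theorem pinnedChain_eq_of_isChainGibbsMeasure_of_isShiftInvariant {ω₂ lam β : ℝ} (γ : ℝ)
    (hω : 0 < ω₂) (hl : 0 ≤ lam) (hβ : 0 ≤ β) {T : ℝ} (hT : 0 < T) {μ₁ μ₂ : Measure ChainConfig}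
    (h₁ : (pinnedChain ω₂ lam β γ).IsChainGibbsMeasure T μ₁) (hs₁ : IsShiftInvariant μ₁)
    (h₂ : (pinnedChain ω₂ lam β γ).IsChainGibbsMeasure T μ₂) (hs₂ : IsShiftInvariant μ₂) :
    μ₁ = μ₂ := by
  refine (pinnedChain ω₂ lam β γ).eq_of_isChainGibbsMeasure_of_isShiftInvariant hT ?_ ?_ ?_ ?_
    (integrable_exp_neg_pinning hT hω hl β γ) h₁ hs₁ h₂ hs₂
  · show Continuous fun q : ℝ => ω₂ * q ^ 2 / 2 + lam * q ^ 4 / 4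
    fun_prop
  · show Continuous fun r : ℝ => r ^ 2 / 2 + β * r ^ 4 / 4
    fun_prop
  · intro r
    show 0 ≤ r ^ 2 / 2 + β * r ^ 4 / 4
    positivity
  · intro r
    show (-r) ^ 2 / 2 + β * (-r) ^ 4 / 4 = r ^ 2 / 2 + β * r ^ 4 / 4
    ring

end OscillatorChain

end Literature.MathematicalPhysics.KineticTheory.HeatConduction

end
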